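import Summits.AtomisticToContinuum.HydrodynamicLimit.Theses.TwoClocks
import Summits.AtomisticToContinuum.HydrodynamicLimit.Theorems.OneFlightGossipEngineEquilibriumClampedCollisionalWindowLDDefs
import Summits.AtomisticToContinuum.HydrodynamicLimit.Theorems.TwoClocksClampedTransferWindowLDStubStationaryTruncation
import Summits.AtomisticToContinuum.HydrodynamicLimit.Theorems.OneFlightGossipEngineCollisionActivityTailsEndpointTails
import Summits.AtomisticToContinuum.HydrodynamicLimit.Theorems.TwoClocksTransferActivityTailsBlockSum
import Summits.AtomisticToContinuum.HydrodynamicLimit.Theorems.CollisionActivityTails.Negative.Kinematics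
import HarnessLib

/-!
# `TransferActivityTails` (stmt-AtomisticToContinuum-16624) from tails of BLOCK AVERAGES — the block-average dock of line
# `Sketch` (cards `predictor-drift-doob` / `heavy-block-pattern-cost`), with the line's definitions

Crux `Summit.AtomisticToContinuum.HydrodynamicLimit.Theses.TwoClocks.TransferActivityTails` (route TwoClocks, rank 7): the
a-priori `L¹` tail bound `E_λ[(N+1)⁻¹ Σ_i a_i 𝟙{a_i > V}] ≤ ε` for the window TRANSFER activity
`a_i(s) = (σ/τ) Σ_{collisions of i in (s, s+w]} (‖v_i⁺ − v_i⁻‖ + |‖v_i⁺‖² − ‖v_i⁻‖²|/2)`, `w = τ (N+1)^{-1/3}`, under the true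
evolution from local Gibbs data.

THE LINE (skeleton `Cruxes/TransferActivityTails/Lines/Sketch.lean`, lead prover-line-stmt-AtomisticToContinuum-16624-c6-0; cards
`Cruxes/TransferActivityTails/Ideas/predictor-drift-doob.md`, `…/heavy-block-pattern-cost.md`).  Cut the window into `K`
consecutive blocks of `τ₁ (N+1)^{-1/3}`; the window activity is (up to a factor-2 sandwich for `τ ∉ τ₁ℕ`) the AVERAGE
`ā_i = K⁻¹ Σ_{j<K} X_{i,j}` of the block activities `X_{i,j} = BlockAct σ τ₁ Φ i j s`.  This file carries

* the line's OBJECTS (`actSummand`, `BlockAct`, `InCruxFrame`) and its route-internal POSITS (open, typed, not claimed):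
  (CD) `PredictorDrift τ₁` — one-step Foster–Lyapunov drift of the predictor of the next block given the particle's own block
  history; (UI₁) `OneBlockUI τ₁` — one-block uniform integrability; (PC) `HeavyBlockPatternCost τ₁` — exponential cost per heavy
  block uniformly over temporal patterns (the sibling card); all with their constants chosen INSIDE the crux's frame (after the
  profiles, `σ`, the Euler solution, the flows and `t` — a level chosen before the profiles is refuted by heating the data);
* the INTERMEDIATE DOCK `BlockAverageTails τ₁` — `L¹` tails of the block averages at one block length — and the proof that it
  implies the crux by kinematics alone (`transferActivityTails_of_blockAverageTails`, registered `stub_blockAverageDock`):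
  `V₀ := 2V'`, `K := ⌈τ/τ₁⌉` (`τ ≤ Kτ₁ ≤ 2τ`), window monotonicity + concatenation on the good set
  (`TransferActivityTailsBlockSum.stub_blockSum`, p141391) give `a_i^τ ≤ 2 ā_i`, hence `a_i𝟙{a_i > V} ≤ 2 ā_i 𝟙{ā_i > V'}`.
The two engines dock here: `TwoClocksTransferActivityTailsDrift.lean` ((CD) ∧ (UI₁) ⟹ `BlockAverageTails`, drift ⇒ LLN engine)
and `TwoClocksTransferActivityTailsPatternCost.lean` ((PC) ∧ (UI₁) ⟹ `BlockAverageTails`, pattern counting).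
-/

noncomputable section

open MeasureTheory Set Filter Topology
open scoped ENNReal BigOperators

namespace Summit.AtomisticToContinuum.HydrodynamicLimit.Theorems.TransferActivityTailsBlockDrift

open Literature.MathematicalPhysics.KineticTheory Literature.Analysis.FluidPDE
open Summit.AtomisticToContinuum.HydrodynamicLimit.Theorems.ClampedTransferCoin
  (Flow Phase Rec window impulse window_pos collisionSum_Ioc_add_Ioc)
open Summit.AtomisticToContinuum.HydrodynamicLimit.Theorems.CollisionActivityTailsEndpointTails
  (tailFn tailFn_of_lt tailFn_of_le measurable_tailFn ae_mem_good_localGibbsLaw)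

/-! ## §1 Objects and posits of the line -/

/-- The crux's tagged transfer summand of particle `i`: `𝟙{c.fst = i} · (‖v⁺ − v⁻‖ + |‖v⁺‖² − ‖v⁻‖²|/2)` (momentum impulse +
energy impulse of the first particle of the record; definitionally the inline lambda of `TwoClocks.TransferActivityTails`).
Route-internal definition of line Sketch, crux TransferActivityTails, not a cited fact. -/
def actSummand {N : ℕ} (i : Fin (N + 1)) (c : Rec N) : ℝ :=
  if c.fst = i then impulse c else 0

/-- **Block transfer activity** `X_{i,j}(s)`: the transfer activity of particle `i` over the `j`-th block
`(s + j·w₁, s + (j+1)·w₁]` of length `w₁ = window τ₁ N = τ₁ (N+1)^{-1/3}` after the macroscopic time `s`, along the orbit of the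
datum `z` under the flow `Φ`, normalised per block (prefactor `σ/τ₁`), so that for `τ = K τ₁` the crux's window activity is the
block average `K⁻¹ Σ_{j<K} X_{i,j}(s)` on the good set.  Route-internal definition of line Sketch, not a cited fact. -/
def BlockAct (σ τ₁ : ℝ) {N : ℕ} (Φ : Flow σ N) (i : Fin (N + 1)) (j : ℕ) (s : ℝ) (z : Phase N) : ℝ :=
  σ / τ₁ * Φ.collisionSum (Set.Ioc (s + j * window τ₁ N) (s + (j + 1) * window τ₁ N)) (actSummand i) z

/-- The crux's frame — the quantifier prefix of `TwoClocks.TransferActivityTails` up to `∀ t ∈ Ico 0 T` (continuous positive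
profiles, `σ < σ₀`, a classical hard-sphere Euler solution on `[0,T)`, every flow family, the `t = 0` law of large numbers for
the local Gibbs data), abstracted over the conclusion `Q σ t Φ P` with `P N` the local Gibbs law through `Φ N`.
Route-internal definition of line Sketch, not a cited fact. -/
def InCruxFrame (Q : (σ : ℝ) → ℝ → ((N : ℕ) → Flow σ N) → ((N : ℕ) → Measure (Phase N)) → Prop) : Prop :=
  ∀ (a₀ θ₀ : T3 → ℝ) (u₀ : T3 → V3), Continuous a₀ → Continuous θ₀ → Continuous u₀ →
    (∀ x, 0 < a₀ x) → (∀ x, 0 < θ₀ x) → ∃ σ₀ : ℝ, 0 < σ₀ ∧ ∀ σ : ℝ, 0 < σ → σ < σ₀ →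
    ∀ (T : ℝ) (ρ θ : ℝ → T3 → ℝ) (u : ℝ → T3 → V3), IsHardSphereEulerSolution σ T ρ u θ →
    ∀ Φ : (N : ℕ) → Flow σ N,
    TendstoHydroFieldsAt (fun N => localGibbsLaw σ a₀ u₀ θ₀ N (Φ N)) Φ ρ u θ 0 →
    ∀ t ∈ Set.Ico 0 T, Q σ t Φ (fun N => localGibbsLaw σ a₀ u₀ θ₀ N (Φ N))

/-- **(CD) Predictor drift along the tagged particle's own block-activity history** (conjecture-grade; the line's dynamical
input, card `predictor-drift-doob` §Lever), block length `τ₁`, integrated form: in the crux's frame there are a contraction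
`0 ≤ ρ < 1`, a constant `C ≥ 0` and a history length `L ≥ 1` (depending on the profiles, `σ`, the solution, the flows and `t`,
like the crux's `V₀`) such that for every number of blocks `K ≥ 1`, all `N ≥ N₀(K)`, every start `s ∈ [0, t]`, particle `i`,
block index `j` with `L ≤ j + 1 < K`, and every measurable functional `g` of the history `(X_{i,0}, …, X_{i,j})` with values in
`[0, 1]`:  `∫ X_{i,j+1} · g(hist) dλ₀ ≤ ∫ (ρ · L⁻¹ Σ_{k<L} X_{i,j+1−L+k} + C) · g(hist) dλ₀` — equivalently
`E[X_{i,j+1} | σ(X_{i,≤j})] ≤ ρ H_{i,j} + C` a.s.: "hyperactivity is not self-sustaining in conditional mean, one block ahead".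
At constant profiles it quantifies the fixed-level content (N1) of the crux one step at a time; under the true law at `s > 0` it
contains the persistent-droplet exclusion (N2).  Route-internal proposition of line Sketch, crux TransferActivityTails
(stmt-AtomisticToContinuum-16624), NOT a cited fact and not claimed. -/
def PredictorDrift (τ₁ : ℝ) : Prop :=
  InCruxFrame fun σ t Φ P =>
    ∃ (ρ C : ℝ) (L : ℕ), 0 ≤ ρ ∧ ρ < 1 ∧ 0 ≤ C ∧ 1 ≤ L ∧
    ∀ K : ℕ, 1 ≤ K → ∃ N₀ : ℕ, ∀ N : ℕ, N₀ ≤ N → ∀ s ∈ Set.Icc 0 t, ∀ i : Fin (N + 1),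
    ∀ j : ℕ, L ≤ j + 1 → j + 1 < K →
    ∀ g : (Fin (j + 1) → ℝ) → ℝ, Measurable g → (∀ y, 0 ≤ g y ∧ g y ≤ 1) →
      ∫⁻ z, ENNReal.ofReal (BlockAct σ τ₁ (Φ N) i (j + 1) s z *
          g (fun k => BlockAct σ τ₁ (Φ N) i k s z)) ∂(P N) ≤
      ∫⁻ z, ENNReal.ofReal ((ρ * ((L : ℝ)⁻¹ * ∑ k ∈ Finset.range L, BlockAct σ τ₁ (Φ N) i (j + 1 - L + k) s z) + C) *
          g (fun k => BlockAct σ τ₁ (Φ N) i k s z)) ∂(P N)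

/-- **(UI₁) One-block uniform integrability under the true law** (conjecture-grade; the line's a-priori input, card
`predictor-drift-doob` §Lever), block length `τ₁`: in the crux's frame, for every accuracy `δ > 0` there is a level `M ≥ 0` such
that for every `K ≥ 1`, all `N ≥ N₀(K)`, every `s ∈ [0, t]` and every block `j < K`:
`E_{λ₀}[(N+1)⁻¹ Σ_i (X_{i,j}(s) − M)₊] ≤ δ` (UI-shape: the level after the accuracy; particle-averaged, one block).
Route-internal proposition of line Sketch, crux TransferActivityTails (stmt-AtomisticToContinuum-16624), NOT a cited fact and
not claimed. -/
def OneBlockUI (τ₁ : ℝ) : Prop :=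
  InCruxFrame fun σ t Φ P =>
    ∀ δ : ℝ, 0 < δ → ∃ M : ℝ, 0 ≤ M ∧ ∀ K : ℕ, 1 ≤ K → ∃ N₀ : ℕ, ∀ N : ℕ, N₀ ≤ N →
    ∀ s ∈ Set.Icc 0 t, ∀ j : ℕ, j < K →
      ∫⁻ z, ENNReal.ofReal (((N : ℝ) + 1)⁻¹ * ∑ i : Fin (N + 1), max (BlockAct σ τ₁ (Φ N) i j s z - M) 0)
        ∂(P N) ≤ ENNReal.ofReal δ

/-- **(PC) Exponential cost per heavy block, uniformly over temporal patterns** (conjecture-grade; the sibling card's dynamical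
input, `Cruxes/TransferActivityTails/Ideas/heavy-block-pattern-cost.md` §Lever), block length `τ₁`: in the crux's frame there are a
base level `y₀ > 0` and a base cost `c₀ ≥ 3` (depending on the profiles, `σ`, the solution, the flows and `t`) such that for every
`K ≥ 1`, all `N ≥ N₀(K)`, every `s ∈ [0, t]`, particle `i`, dyadic exponent `m` and nonempty set `S` of block indices `< K`:
`λ₀(X_{i,j}(s) > y₀ 2^m for all j ∈ S) ≤ exp(−(c₀ + 2m)·|S|)` — "`τ` in the exponent of the NUMBER of heavy blocks of one particle,
never of its activity" (indicator currency, untouched by the refuted exponential-moment strengthening).  Route-internal proposition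
of line Sketch, crux TransferActivityTails (stmt-AtomisticToContinuum-16624), NOT a cited fact and not claimed. -/
def HeavyBlockPatternCost (τ₁ : ℝ) : Prop :=
  InCruxFrame fun σ t Φ P =>
    ∃ (y₀ c₀ : ℝ), 0 < y₀ ∧ 3 ≤ c₀ ∧
    ∀ K : ℕ, 1 ≤ K → ∃ N₀ : ℕ, ∀ N : ℕ, N₀ ≤ N → ∀ s ∈ Set.Icc 0 t, ∀ i : Fin (N + 1),
    ∀ m : ℕ, ∀ S : Finset (Fin K), S.Nonempty →
      (P N) {z | ∀ j ∈ S, y₀ * 2 ^ m < BlockAct σ τ₁ (Φ N) i j s z} ≤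
        ENNReal.ofReal (Real.exp (-((c₀ + 2 * m) * S.card)))


/-! ## Elementary facts about the objects -/

variable {σ : ℝ} {N : ℕ}

/-- The tagged transfer summand is the crux's inline summand (definitional unfolding, recorded for rewriting). -/
theorem actSummand_eq (i : Fin (N + 1)) :
    actSummand i = fun c : Rec N =>
      if c.fst = i then ‖c.postVel.1 - c.preVel.1‖ + |‖c.postVel.1‖ ^ 2 - ‖c.preVel.1‖ ^ 2| / 2 else 0 :=
  rfl

/-- The tagged transfer summand is nonnegative. -/
theorem actSummand_nonneg (i : Fin (N + 1)) (c : Rec N) : 0 ≤ actSummand i c := by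
  unfold actSummand impulse
  split_ifs
  · positivity
  · exact le_rfl

/-- Collision sums along the flow of a nonnegative functional are nonnegative (every datum: a `finsum` of finite sums). -/
theorem collisionSum_nonneg_of_nonneg (Φ : Flow σ N) (S : Set ℝ) {F : Rec N → ℝ} (hF : ∀ c, 0 ≤ F c)
    (z : Phase N) : 0 ≤ Φ.collisionSum S F z := by
  unfold HardSphereFlow.collisionSum Literature.Analysis.FluidPDE.collisionSum
    Literature.Analysis.FluidPDE.collisionPairSum
  exact finsum_nonneg fun t => finsum_nonneg fun _ => Finset.sum_nonneg fun p _ => hF _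

/-- The block activity is nonnegative for `0 ≤ σ`, `0 ≤ τ₁` (every datum). -/
theorem blockAct_nonneg (hσ : 0 ≤ σ) {τ₁ : ℝ} (hτ₁ : 0 ≤ τ₁) (Φ : Flow σ N) (i : Fin (N + 1)) (j : ℕ)
    (s : ℝ) (z : Phase N) : 0 ≤ BlockAct σ τ₁ Φ i j s z :=
  mul_nonneg (div_nonneg hσ hτ₁) (collisionSum_nonneg_of_nonneg Φ _ (actSummand_nonneg i) z)


/-! ## §2 Window monotonicity and the tail functional
(antitonicity of the tail in the level is the landed `CollisionActivityTailsNegative.tailFn_anti`) -/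

/-- Monotonicity of window collision sums of a nonnegative functional in the window length, on the good set. -/
theorem collisionSum_Ioc_mono_right (Φ : Flow σ N) {z : Phase N} (hz : z ∈ Φ.good) {F : Rec N → ℝ}
    (hF : ∀ c, 0 ≤ F c) (s : ℝ) {w w' : ℝ} (hw : 0 ≤ w) (hww' : w ≤ w') :
    Φ.collisionSum (Set.Ioc s (s + w)) F z ≤ Φ.collisionSum (Set.Ioc s (s + w')) F z := by
  rw [collisionSum_Ioc_add_Ioc Φ hz (by linarith) (by linarith : s + w ≤ s + w') F]
  exact le_add_of_nonneg_right (collisionSum_nonneg_of_nonneg Φ _ hF z)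

/-- The sandwich step: `0 ≤ a ≤ 2 b` gives `a 𝟙{a > V} ≤ 2 · b 𝟙{b > V/2}`. -/
theorem tailFn_le_two_mul {V a b : ℝ} (ha : 0 ≤ a) (hab : a ≤ 2 * b) : tailFn V a ≤ 2 * tailFn (V / 2) b := by
  have hb : 0 ≤ b := by linarith
  by_cases h : V < a
  · rw [tailFn_of_lt h, tailFn_of_lt (by linarith : V / 2 < b)]; exact hab
  · rw [tailFn_of_le (not_lt.1 h)]; exact mul_nonneg zero_le_two (Set.indicator_apply_nonneg fun _ => hb)

/-! ## §3 The intermediate dock: tails of the BLOCK AVERAGES at a fixed block length -/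

/-- **Block-average tails at block length `τ₁`** (the line's intermediate dock, route-internal, not a cited fact): in the
crux's frame there is a level `V' > 0` such that for every accuracy `ε > 0` there is `K₀ ≥ 1` with: for every number of
blocks `K ≥ K₀`, all large `N` and every start `s ∈ [0, t]`,
`E_{λ₀}[(N+1)⁻¹ Σ_i ā_i 𝟙{ā_i > V'}] ≤ ε`, `ā_i := K⁻¹ Σ_{j<K} X_{i,j}(s)` the average of the block activities.
The crux follows by kinematics alone (`stub_blockAverageDock`); the drift engine produces it from
(CD) ∧ (UI₁) (`blockAverageTails_of_drift`). -/
def BlockAverageTails (τ₁ : ℝ) : Prop :=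
  InCruxFrame fun σ t Φ P =>
    ∃ V' : ℝ, 0 < V' ∧ ∀ ε : ℝ, 0 < ε → ∃ K₀ : ℕ, 1 ≤ K₀ ∧ ∀ K : ℕ, K₀ ≤ K → ∃ N₀ : ℕ, ∀ N : ℕ, N₀ ≤ N →
    ∀ s ∈ Set.Icc 0 t,
      ∫⁻ z, ENNReal.ofReal (((N : ℝ) + 1)⁻¹ * ∑ i : Fin (N + 1),
        tailFn V' ((K : ℝ)⁻¹ * ∑ j ∈ Finset.range K, BlockAct σ τ₁ (Φ N) i j s z)) ∂(P N) ≤ ENNReal.ofReal ε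

/-- **The crux from block-average tails (kinematics only).**  `V₀ := 2V'`; given `V ≥ V₀`, `ε`: `K₀(ε/2)`, `τ₀ := K₀ τ₁`;
for `τ ≥ τ₀` put `K := ⌈τ/τ₁⌉` (`K₀ ≤ K`, `τ ≤ Kτ₁ ≤ 2τ`) and `N₀ := N₀(K)`; on the good set (full local Gibbs measure)
the window `(s, s + τ(N+1)^{-1/3}]` lies inside the `K` blocks, so `a_i^τ ≤ (Kτ₁/τ) ā_i ≤ 2 ā_i` (window monotonicity,
concatenation `TransferActivityTailsBlockSum.stub_blockSum`), hence `a_i 𝟙{a_i > V} ≤ 2 ā_i 𝟙{ā_i > V/2} ≤ 2 ā_i 𝟙{ā_i > V'}`;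
integrate. -/
theorem stub_blockAverageDock : (∃ τ₁ : ℝ, 0 < τ₁ ∧ BlockAverageTails τ₁) →
    Summit.AtomisticToContinuum.HydrodynamicLimit.Theses.TwoClocks.TransferActivityTails := by
  intro h
  have hSum := TransferActivityTailsBlockSum.stub_blockSum
  obtain ⟨τ₁, hτ₁, hBA⟩ := h
  intro a₀ θ₀ u₀ ha hθ hu ha0 hθ0
  obtain ⟨σA, hσA, HA⟩ := hBA a₀ θ₀ u₀ ha hθ hu ha0 hθ0
  refine ⟨σA, hσA, ?_⟩
  intro σ hσ hσlt T ρE θE uE hE Φ hlim t ht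
  obtain ⟨V', hV'pos, HV⟩ := HA σ hσ hσlt T ρE θE uE hE Φ hlim t ht
  refine ⟨2 * V', by positivity, ?_⟩
  intro V hV ε hε
  obtain ⟨K₀, hK₀1, HK⟩ := HV (ε / 2) (by positivity)
  have hK₀pos : (0 : ℝ) < K₀ := by exact_mod_cast hK₀1
  refine ⟨K₀ * τ₁, by positivity, ?_⟩
  intro τ hτ
  have hτpos : 0 < τ := lt_of_lt_of_le (by positivity) hτ
  have hτ₁τ : τ₁ ≤ τ := by
    have : (1 : ℝ) ≤ K₀ := by exact_mod_cast hK₀1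
    nlinarith
  set K : ℕ := ⌈τ / τ₁⌉₊ with hKdef
  have hKτ : τ / τ₁ ≤ K := Nat.le_ceil _
  have hK₀K' : (K₀ : ℝ) ≤ τ / τ₁ := by rw [le_div_iff₀ hτ₁]; exact hτ
  have hK₀K : K₀ ≤ K := Nat.cast_le.1 (hK₀K'.trans hKτ)
  have hK1 : 1 ≤ K := le_trans hK₀1 hK₀K
  have hKpos : (0 : ℝ) < K := by exact_mod_cast hK1
  have hτK : τ ≤ K * τ₁ := by rwa [div_le_iff₀ hτ₁] at hKτ
  have hKτ2 : K * τ₁ ≤ 2 * τ := by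
    have h1 : (K : ℝ) < τ / τ₁ + 1 := Nat.ceil_lt_add_one (by positivity)
    have h2 : (K : ℝ) * τ₁ < τ + τ₁ := by
      have := mul_lt_mul_of_pos_right h1 hτ₁
      rwa [add_mul, one_mul, div_mul_cancel₀ _ hτ₁.ne'] at this
    linarith
  obtain ⟨N₀, HN⟩ := HK K hK₀K
  refine ⟨N₀, ?_⟩
  intro N hN s hs
  dsimp only
  set P := localGibbsLaw σ a₀ u₀ θ₀ N (Φ N) with hP
  have hgood : ∀ᵐ z ∂P, z ∈ (Φ N).good := ae_mem_good_localGibbsLaw σ a₀ θ₀ u₀ N (Φ N)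
  have hmain' := HN N hN s hs
  -- pointwise on the good set: `a_i^τ ≤ 2 ā_i`, hence the crux integrand ≤ 2 × the dock's integrand
  have hwin : window τ N ≤ K * window τ₁ N := by
    unfold window
    rw [← mul_assoc]
    exact mul_le_mul_of_nonneg_right hτK (by positivity)
  have hptw : ∀ᵐ z ∂P, ((N : ℝ) + 1)⁻¹ * ∑ i : Fin (N + 1),
      tailFn V (σ / τ * (Φ N).collisionSum (Set.Ioc s (s + window τ N)) (actSummand i) z) ≤
      2 * (((N : ℝ) + 1)⁻¹ * ∑ i : Fin (N + 1),
        tailFn V' ((K : ℝ)⁻¹ * ∑ j ∈ Finset.range K, BlockAct σ τ₁ (Φ N) i j s z)) := by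
    filter_upwards [hgood] with z hz
    suffices key : ∀ i : Fin (N + 1),
        tailFn V (σ / τ * (Φ N).collisionSum (Set.Ioc s (s + window τ N)) (actSummand i) z) ≤
        2 * tailFn V' ((K : ℝ)⁻¹ * ∑ j ∈ Finset.range K, BlockAct σ τ₁ (Φ N) i j s z) by
      calc ((N : ℝ) + 1)⁻¹ * ∑ i : Fin (N + 1),
            tailFn V (σ / τ * (Φ N).collisionSum (Set.Ioc s (s + window τ N)) (actSummand i) z)
          ≤ ((N : ℝ) + 1)⁻¹ * ∑ i : Fin (N + 1),
              2 * tailFn V' ((K : ℝ)⁻¹ * ∑ j ∈ Finset.range K, BlockAct σ τ₁ (Φ N) i j s z) :=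
            mul_le_mul_of_nonneg_left (Finset.sum_le_sum fun i _ => key i) (by positivity)
        _ = 2 * (((N : ℝ) + 1)⁻¹ * ∑ i : Fin (N + 1),
              tailFn V' ((K : ℝ)⁻¹ * ∑ j ∈ Finset.range K, BlockAct σ τ₁ (Φ N) i j s z)) := by
            rw [← Finset.mul_sum]; ring
    intro i
    -- `a_i ≤ (K τ₁ / τ) ā_i ≤ 2 ā_i`
    set abar : ℝ := (K : ℝ)⁻¹ * ∑ j ∈ Finset.range K, BlockAct σ τ₁ (Φ N) i j s z with habar
    have habar0 : 0 ≤ abar := mul_nonneg (inv_nonneg.2 hKpos.le)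
      (Finset.sum_nonneg fun j _ => blockAct_nonneg hσ.le hτ₁.le (Φ N) i j s z)
    have hblocks : (Φ N).collisionSum (Set.Ioc s (s + K * window τ₁ N)) (actSummand i) z =
        ∑ j ∈ Finset.range K, (Φ N).collisionSum
          (Set.Ioc (s + j * window τ₁ N) (s + (j + 1) * window τ₁ N)) (actSummand i) z :=
      hSum σ N (Φ N) z hz s (window τ₁ N) (window_pos hτ₁ N).le (actSummand i) K
    have hsumX : ∑ j ∈ Finset.range K, BlockAct σ τ₁ (Φ N) i j s z =
        σ / τ₁ * ∑ j ∈ Finset.range K, (Φ N).collisionSum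
          (Set.Ioc (s + j * window τ₁ N) (s + (j + 1) * window τ₁ N)) (actSummand i) z := by
      rw [Finset.mul_sum]
      rfl
    have hact : σ / τ * (Φ N).collisionSum (Set.Ioc s (s + window τ N)) (actSummand i) z ≤ 2 * abar := by
      calc σ / τ * (Φ N).collisionSum (Set.Ioc s (s + window τ N)) (actSummand i) z
          ≤ σ / τ * (Φ N).collisionSum (Set.Ioc s (s + K * window τ₁ N)) (actSummand i) z :=
            mul_le_mul_of_nonneg_left (collisionSum_Ioc_mono_right (Φ N) hz (actSummand_nonneg i) s
              (window_pos hτpos N).le hwin) (div_nonneg hσ.le hτpos.le)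
        _ = (K * τ₁ / τ) * abar := by
            rw [hblocks, habar, hsumX]
            generalize (∑ j ∈ Finset.range K, (Φ N).collisionSum
              (Set.Ioc (s + j * window τ₁ N) (s + (j + 1) * window τ₁ N)) (actSummand i) z) = S
            have hK0 : (K : ℝ) ≠ 0 := hKpos.ne'
            have hτ0 : τ ≠ 0 := hτpos.ne'
            have hτ₁0 : τ₁ ≠ 0 := hτ₁.ne'
            field_simp
        _ ≤ 2 * abar := by
            refine mul_le_mul_of_nonneg_right ?_ habar0
            rwa [div_le_iff₀ hτpos]
    calc tailFn V (σ / τ * (Φ N).collisionSum (Set.Ioc s (s + window τ N)) (actSummand i) z)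
        ≤ 2 * tailFn (V / 2) abar :=
          tailFn_le_two_mul (mul_nonneg (div_nonneg hσ.le hτpos.le)
            (collisionSum_nonneg_of_nonneg _ _ (actSummand_nonneg i) z)) hact
      _ ≤ 2 * tailFn V' abar :=
          mul_le_mul_of_nonneg_left (CollisionActivityTailsNegative.tailFn_anti (by linarith) habar0) zero_le_two
  -- conclusion
  have hsummand : ∀ i : Fin (N + 1), (fun c : Rec N => if c.fst = i then
      ‖c.postVel.1 - c.preVel.1‖ + |‖c.postVel.1‖ ^ 2 - ‖c.preVel.1‖ ^ 2| / 2 else 0) = actSummand i :=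
    fun i => rfl
  simp only [hsummand]
  calc ∫⁻ z, ENNReal.ofReal (((N : ℝ) + 1)⁻¹ * ∑ i : Fin (N + 1),
          tailFn V (σ / τ * (Φ N).collisionSum (Set.Ioc s (s + window τ N)) (actSummand i) z)) ∂P
      ≤ ∫⁻ z, ENNReal.ofReal (2 * (((N : ℝ) + 1)⁻¹ * ∑ i : Fin (N + 1),
          tailFn V' ((K : ℝ)⁻¹ * ∑ j ∈ Finset.range K, BlockAct σ τ₁ (Φ N) i j s z))) ∂P :=
        lintegral_mono_ae (hptw.mono fun z hz => ENNReal.ofReal_le_ofReal hz)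
    _ = ENNReal.ofReal 2 * ∫⁻ z, ENNReal.ofReal (((N : ℝ) + 1)⁻¹ * ∑ i : Fin (N + 1),
          tailFn V' ((K : ℝ)⁻¹ * ∑ j ∈ Finset.range K, BlockAct σ τ₁ (Φ N) i j s z)) ∂P := by
        rw [← lintegral_const_mul' _ _ ENNReal.ofReal_ne_top]
        refine lintegral_congr fun z => ?_
        rw [ENNReal.ofReal_mul zero_le_two]
    _ ≤ ENNReal.ofReal 2 * ENNReal.ofReal (ε / 2) := mul_le_mul_right hmain' _
    _ = ENNReal.ofReal ε := by rw [← ENNReal.ofReal_mul zero_le_two]; congr 1; ring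

end Summit.AtomisticToContinuum.HydrodynamicLimit.Theorems.TransferActivityTailsBlockDrift

end
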